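import Summits.ABC.IUTFork.Repair.RHCellSlackExactStatement
import Summits.ABC.IUTFork.Repair.RHSigmaSignedRemainder
import HarnessLib

/-!
# R-H / D-0121 junction «SURPLUS = SLACK» in the NETTING currency: at the sharp real setting of record q2-eq's `cellDeficit`, `credit`,
# `offRemainder ∅` and `signedRemainder` ARE abc-iut-rh-typ-4's weighted exact-U2 margin bill, cell by cell and in total

abc-iut cell, rung LADDER-ABC:A2.RESCUE.H, R-H seat abc-iut-rh2-q2-eq (gen 4). PROOF-ONLY junction (0 definitions, 0 `Prop` facts, no instance, no
notation) of TWO landed lineages, answering rh-lead's D-0121 R30 (1) («is there a decl that equates the SETTING's credit with the exact cell's slack?»)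
with ONE decl per named number of the netting currency:
* this seat's `RHSigmaLicence.lean` (p468453: `cellDeficit P i v_ℚ := qLocal − logvol(ⁿ˚𝒰)`), `RHSigmaLicenceInvariance.lean` (p476178:
  `offRemainder_empty_eq`), `RHSigmaSignedRemainder.lean` (p480491: `credit := PN Σᶠ (−cellDeficit)⁺`, `signedRemainder := PN Σᶠ cellDeficit`) — GENERIC
  over any `Cor312.Setting`;
* abc-iut-rh-typ-4's `RHCellSlackExact.lean` (p481438: **`cellSlack_settingPrVolSharp_eq`** — at abc-iut-c312-7's sharp print-normalised real setting
  `Thm311.Real.settingPrVolSharp X …`, for every pilot data, every non-zero Θ-ideles (units off `S`) and `q`-ideles,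
  `logvol(ⁿ˒°𝒰_{i+1,p}) − qLocal_{i+1,p} = Σ_{v⃗} Pr(v⃗)·(−m(v⃗)·log p + Σ_a log‖c^out(v_a)‖ − log‖t_{q,v_{i+1}}‖)`, kernel binders: exact content
  `m` (`hm0`/`hm1`), outer radius `c^out` (`houtΛ`/`hdom`); §4 ROOM bounds) and `RHCellSlackExactStatement.lean` (p482070: archimedean cells `0`,
  `finsum_cellSlack_settingPrVolSharp_eq`, `finsum_sum_eq_finsum_inr`).

WHAT IS PROVED (namespace `Summit.ABC.IUTFork.Repair.RH.SigmaStrataEq`; the bracket `β_{i,p}(v⃗) := −m(v⃗)·log p + Σ_a log‖c^out(v_a)‖ − log‖t_{q,v_{i+1}}‖`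
is `(log p)·μ(v⃗)`, `μ(v⃗) = v_p(t_q) − Σ_a β_a − m(v⃗)`, and at the diagonal packet of ONE field `(log p/e_w)·(price_j − demand_j)` by abc-iut-rh-typ-4
p483291 `RHCellSlackExactOrders.cellSlack_diag_orders` + abc-iut-rh2-w-2 p484893 `RH.HullCellSliceLicence.orders_iff_hullCellδ`):
* §1 PER CELL: **`cellDeficit_settingPrVolSharp_inr_eq`** «`cellDeficit_{i,p} = −Σ_{v⃗} Pr(v⃗)·β_{i,p}(v⃗)`» (the deficit IS minus the weighted margin);
  `cellDeficit_settingPrVolSharp_inl` «archimedean cells: `0`»; `cellCredit_settingPrVolSharp_inr_eq` «`(−cellDeficit_{i,p})⁺ = (Σ_{v⃗} Pr(v⃗)·β)⁺`» — the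
  credit summand of `credit` IS the positive part of the weighted margin: SURPLUS = SLACK, equality, size not sign only; `cellDebt_settingPrVolSharp_inr_eq`
  «`(cellDeficit_{i,p})⁺ = (−Σ_{v⃗} Pr(v⃗)·β)⁺`» (the debt summand of `R_∅`).
* §2 ROOM ⟹ CREDIT (abc-iut-rh3-gen-2's G2-CREDIT± in the netting currency): `sum_room_mul_log_le_neg_cellDeficit_settingPrVolSharp` «room `p^{r(v⃗)}` inside the
  hull box at every tuple ⟹ `(Σ Pr(v⃗)·r(v⃗))·log p ≤ −cellDeficit_{i,p}`», `sum_room_mul_log_le_cellCredit_settingPrVolSharp` (`≤ (−cellDeficit)⁺`),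
  `neg_sum_room_mul_log_le_cellDeficit_settingPrVolSharp` (the reverse bound from room ABOVE the hull box: no more credit than room).
* §3 IN TOTAL (content family `m_{i,p}`, outer radii `c^out_p` at every place): `finsum_cellDeficit_settingPrVolSharp_eq` (label by label),
  **`signedRemainder_settingPrVolSharp_eq`** «`D = −PN(i ↦ Σᶠ_p Σ_{v⃗} Pr·β)`» (the LEAST slack is MINUS typ-4's full signed bill — so p482070's
  `statement_settingPrVolSharp_iff_avg_signedBill` is `statement_iff_signedRemainder_nonpos` read through this identity), **`credit_settingPrVolSharp_eq`**
  «`C = PN(i ↦ Σᶠ_p (Σ_{v⃗} Pr·β)⁺)`», **`offRemainder_empty_settingPrVolSharp_eq`** «`R_∅ = PN(i ↦ Σᶠ_p (Σ_{v⃗} Pr·β)⁻)`» — the three numbers of the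
  D-0121 grid (debt `R`, credit `C`, netted `T′ = (R − C)⁺ = D⁺`) in typ-4's kernel binders, by name.
HONEST SCOPE (typ-4's, inherited verbatim): per PACKET `(j,p)`, a Pr-weighted sum over tuples; the split per PLACE is exact at diagonal packets of
uniform (Galois) fibres (which completion carries which `(e, D, R_in, R_out, m_q)`: abc-iut-c312-3 `UnitLogMaxNorm`; Galois descent: abc-iut-s2
`Cor312ThetaSideGaloisDescent`); mixed tuples carry their own `m(v⃗)`; TIE places (`e_w = p^a(p−1)`) have only an upper bound on `‖c^out‖` in closed
form. Nothing here evaluates any bill at genuine data, asserts or denies [IUTchIII] Cor. 3.12, bears on abc, or takes a side on any author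
(Mochizuki / Scholze–Stix / Joshi / Dupuy–Hilado); typed ≠ proved; instantiated ≠ endorsed. [claim: Mochizuki2012, status: disputed] for every IUT
locution. [cite: Mochizuki2012, IUTchIII Cor. 3.12 p. 173–175, Prop. 3.9 (i)–(iii) p. 115–116; IUTchIV Prop. 1.4 (iii) p. 13–14]
[cite: DupuyHilado2025, §3.6, §3.7, §3.9, §4.9, §4.12]
-/

noncomputable section

open Set Function NumberField IsDedekindDomain
open scoped Pointwise

namespace Summit.ABC.IUTFork.Repair.RH.SigmaStrataEq

open Summit.ABC.IUTFork.Thm311 Summit.ABC.IUTFork.Thm311.Real Summit.ABC.IUTFork.Cor312 Summit.ABC.IUTFork.Cor312.Setting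
  Summit.ABC.IUTFork.Cor312Vol Literature.IUT.LogThetaLattice Literature.IUT.LogVolume
  Summit.ABC.IUTFork.Repair.RH.SigmaLicence Summit.ABC.IUTFork.Repair.RHCellSlackExact
  Summit.ABC.IUTFork.Repair.RHCellSlackExactStatement

variable {F : Type} [Field F] [NumberField F] (X : PilotData F) {logv : PadicLogs F} (hlog : LogvAnalytic logv)
  (M : Type) [Field M] [NumberField M]
  (archPk : ∀ (j : (thetaIndex X).Label) (vQ : (thetaIndex X).VQ), Set ((logShellsDH X logv).Packet j vQ))
  (archSub : ∀ (j : (thetaIndex X).Label) (v : (thetaIndex X).V),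
    Set ((logShellsDH X logv).Packet j ((thetaIndex X).over v)))
  (Ψ : ℤ → ∀ v : (thetaIndex X).V, v ∈ (thetaIndex X).Vbad → Set ((logShellsDH X logv).StarPacket v))
  (act : ℤ → ∀ v : (thetaIndex X).V, v ∈ (thetaIndex X).Vbad →
    (logShellsDH X logv).StarPacket v → Module.End ℚ ((logShellsDH X logv).StarPacket v))
  (Mmod : ℤ → ∀ j : (thetaIndex X).LabelStar, Set ((logShellsDH X logv).GlobalPacket j.1))
  (region : ℤ → ∀ j : (thetaIndex X).LabelStar, FinDivisor M → ∀ vQ : (thetaIndex X).VQ,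
    Set ((logShellsDH X logv).Packet j.1 vQ))
  (n : ℤ) {HT : Type} {LogLink : HT → HT → Type} {IsFull : ∀ {s t : HT}, LogLink s t → Prop}
  (lat : LGPGaussianLogThetaLattice LogLink IsFull)
  {Frd : Type} {IsoF : Frd → Frd → Type} {Ob : Frd → Type} {realify : Frd → Frd} {Strip : Type}
  {IsoS : Strip → Strip → Type} {Mv : ∀ v : (thetaIndex X).V, v ∈ (thetaIndex X).Vbad → Type}
  [∀ v h, Monoid (Mv v h)]
  (sig : GlobalLGPFrobenioidSignature (thetaIndex X).lstar (thetaIndex X).V (· ∈ (thetaIndex X).Vbad)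
    Frd IsoF Ob realify Strip IsoS Mv)
  (split : SplittingMonoids Mv) {ObΔ : Type} {N : ∀ v : (thetaIndex X).V, v ∈ (thetaIndex X).Vbad → Type}
  [∀ v h, Monoid (N v h)] (qData : QPilotData ObΔ N)
  (t : ∀ (pp : Nat.Primes) (_ : Fin X.lstar) (x : (thetaIndex X).Fibre (.inr pp)),
    haveI : Fact (pp : ℕ).Prime := ⟨pp.2⟩; kOf X pp.1 x)
  (tq : ∀ (pp : Nat.Primes) (x : (thetaIndex X).Fibre (.inr pp)), haveI : Fact (pp : ℕ).Prime := ⟨pp.2⟩; kOf X pp.1 x)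
  (ht0 : ∀ pp i x, t pp i x ≠ 0)
  (ht1 : ∀ (pp : Nat.Primes) (i : Fin X.lstar) (x : (thetaIndex X).Fibre (.inr pp)),
    haveI : Fact (pp : ℕ).Prime := ⟨pp.2⟩; placeOf X pp.1 x ∉ X.S → ‖t pp i x‖ = 1)
  (htq0 : ∀ pp x, tq pp x ≠ 0)
  (htq1 : ∀ (pp : Nat.Primes) (x : (thetaIndex X).Fibre (.inr pp)),
    haveI : Fact (pp : ℕ).Prime := ⟨pp.2⟩; placeOf X pp.1 x ∉ X.S → ‖tq pp x‖ = 1)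

/-! ## §1. Per cell: the deficit IS minus the weighted exact-U2 margin; the credit summand IS its positive part -/

section Cell

variable (i : Fin (thetaIndex X).lstar) (pp : Nat.Primes)
  (m : ((thetaIndex X).Caps (Setting.labelSucc i) → (thetaIndex X).Fibre (.inr pp)) → ℤ)
  (hm0 : ∀ e : (thetaIndex X).Caps (Setting.labelSucc i) → (thetaIndex X).Fibre (.inr pp),
    haveI : Fact (pp : ℕ).Prime := ⟨pp.2⟩;
    (⋃ a, iota pp.1 ((presAt X hlog pp).kk e) a (t pp i (e a)) •
        (normalizedPacket pp.1 ((presAt X hlog pp).kk e) : Set ((presAt X hlog pp).X e))) ⊆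
      (((pp : ℕ) : ℚ_[pp]) ^ m e) • (logPacket pp.1 ((presAt X hlog pp).kk e) : Set ((presAt X hlog pp).X e)))
  (hm1 : ∀ e : (thetaIndex X).Caps (Setting.labelSucc i) → (thetaIndex X).Fibre (.inr pp),
    haveI : Fact (pp : ℕ).Prime := ⟨pp.2⟩;
    ¬ (⋃ a, iota pp.1 ((presAt X hlog pp).kk e) a (t pp i (e a)) •
        (normalizedPacket pp.1 ((presAt X hlog pp).kk e) : Set ((presAt X hlog pp).X e))) ⊆
      (((pp : ℕ) : ℚ_[pp]) ^ (m e + 1)) • (logPacket pp.1 ((presAt X hlog pp).kk e) : Set ((presAt X hlog pp).X e)))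
  {cout : ∀ x : (thetaIndex X).Fibre (.inr pp), haveI : Fact (pp : ℕ).Prime := ⟨pp.2⟩; (presAt X hlog pp).k x}
  (houtΛ : ∀ x, haveI : Fact (pp : ℕ).Prime := ⟨pp.2⟩; cout x ∈ logUnits ((presAt X hlog pp).k x))
  (hdom : ∀ x, haveI : Fact (pp : ℕ).Prime := ⟨pp.2⟩; ∀ z ∈ logUnits ((presAt X hlog pp).k x), ‖z‖ ≤ ‖cout x‖)

include ht0 ht1 hm0 hm1 houtΛ hdom in
/-- **`cellDeficit_{i,p} = −Σ_{v⃗} Pr(v⃗)·(−m(v⃗)·log p + Σ_a log‖c^out(v_a)‖ − log‖t_{q,v_{i+1}}‖)`** at the sharp real setting of record: q2-eq's deficit of the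
prime cell `(i, p)` (p468453) IS minus abc-iut-rh-typ-4's weighted exact-U2 margin (p481438 `cellSlack_settingPrVolSharp_eq`, the same two terms with the
sign flipped; the setting's column is `n`, `settingPrVolSharp_n`). [cite: DupuyHilado2025, §3.7, §3.9, §4.12] [claim: Mochizuki2012, status: disputed] -/
theorem cellDeficit_settingPrVolSharp_inr_eq :
    haveI : Fact (pp : ℕ).Prime := ⟨pp.2⟩;
    cellDeficit (settingPrVolSharp X hlog M archPk archSub Ψ act Mmod region n lat sig split qData tq t htq0 htq1) i (.inr pp) =
      -∑ e : (presAt X hlog pp).toLocalPieces.E (Setting.labelSucc i),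
        weightPr X pp.1 (Setting.labelSucc i) e *
          (-(m e * Real.log pp) + ∑ a, Real.log ‖cout (e a)‖ - Real.log ‖tq pp (e (Fin.last _))‖) := by
  haveI : Fact (pp : ℕ).Prime := ⟨pp.2⟩
  have h := cellSlack_settingPrVolSharp_eq X hlog M archPk archSub Ψ act Mmod region n lat sig split qData t tq ht0 ht1 htq0 htq1 i pp m
    hm0 hm1 houtΛ hdom
  unfold cellDeficit
  rw [settingPrVolSharp_n]
  linarith

/-- **Archimedean cells have deficit `0`** (p482070 `cellSlack_settingPrVolSharp_inl`: the packet-normalised container is trivial at the archimedean place).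
[cite: Mochizuki2012, IUTchIV Thm. 1.10 Step (vii) p. 30] [claim: Mochizuki2012, status: disputed] -/
theorem cellDeficit_settingPrVolSharp_inl (u : Unit) :
    cellDeficit (settingPrVolSharp X hlog M archPk archSub Ψ act Mmod region n lat sig split qData tq t htq0 htq1) i (.inl u) = 0 := by
  have h := cellSlack_settingPrVolSharp_inl X hlog M archPk archSub Ψ act Mmod region n lat sig split qData t tq htq0 htq1
    (Setting.labelSucc i) u
  unfold cellDeficit
  rw [settingPrVolSharp_n]
  linarith

include ht0 ht1 hm0 hm1 houtΛ hdom in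
/-- **SURPLUS = SLACK for the credit summand: `(−cellDeficit_{i,p})⁺ = (Σ_{v⃗} Pr(v⃗)·(−m·log p + Σ_a log‖c^out‖ − log‖t_q‖))⁺`** — the `(i, p)` summand of
q2-eq's `credit` (p480491) is the positive part of typ-4's weighted margin: an EQUALITY (size, not sign only). [cite: DupuyHilado2025, §4.12]
[claim: Mochizuki2012, status: disputed] -/
theorem cellCredit_settingPrVolSharp_inr_eq :
    haveI : Fact (pp : ℕ).Prime := ⟨pp.2⟩;
    max (-cellDeficit (settingPrVolSharp X hlog M archPk archSub Ψ act Mmod region n lat sig split qData tq t htq0 htq1) i (.inr pp)) 0 =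
      max (∑ e : (presAt X hlog pp).toLocalPieces.E (Setting.labelSucc i),
        weightPr X pp.1 (Setting.labelSucc i) e *
          (-(m e * Real.log pp) + ∑ a, Real.log ‖cout (e a)‖ - Real.log ‖tq pp (e (Fin.last _))‖)) 0 := by
  haveI : Fact (pp : ℕ).Prime := ⟨pp.2⟩
  rw [cellDeficit_settingPrVolSharp_inr_eq X hlog M archPk archSub Ψ act Mmod region n lat sig split qData t tq ht0 ht1 htq0 htq1 i pp m
    hm0 hm1 houtΛ hdom, neg_neg]

include ht0 ht1 hm0 hm1 houtΛ hdom in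
/-- The positive-deficit (DEBT) summand likewise: `(cellDeficit_{i,p})⁺ = (−Σ_{v⃗} Pr(v⃗)·(…))⁺`. [claim: Mochizuki2012, status: disputed] -/
theorem cellDebt_settingPrVolSharp_inr_eq :
    haveI : Fact (pp : ℕ).Prime := ⟨pp.2⟩;
    max (cellDeficit (settingPrVolSharp X hlog M archPk archSub Ψ act Mmod region n lat sig split qData tq t htq0 htq1) i (.inr pp)) 0 =
      max (-∑ e : (presAt X hlog pp).toLocalPieces.E (Setting.labelSucc i),
        weightPr X pp.1 (Setting.labelSucc i) e *
          (-(m e * Real.log pp) + ∑ a, Real.log ‖cout (e a)‖ - Real.log ‖tq pp (e (Fin.last _))‖)) 0 := by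
  haveI : Fact (pp : ℕ).Prime := ⟨pp.2⟩
  rw [cellDeficit_settingPrVolSharp_inr_eq X hlog M archPk archSub Ψ act Mmod region n lat sig split qData t tq ht0 ht1 htq0 htq1 i pp m
    hm0 hm1 houtΛ hdom]

/-! ## §2. ROOM ⟹ CREDIT (G2-CREDIT± in the netting currency) -/

include ht0 ht1 hm0 hm1 houtΛ hdom in
/-- **ROOM BELOW THE HULL BOX IS CREDIT**: if at every tuple `v⃗` over `p` the `q`-box sits inside the hull box with room `p^{r(v⃗)}`
(`p^{m(v⃗)}·‖t_{q,v_j}‖·p^{r(v⃗)} ≤ ∏_a ‖c^out(v_a)‖`, `r(v⃗) ∈ ℤ` of any sign), then `(Σ_{v⃗} Pr(v⃗)·r(v⃗))·log p ≤ −cellDeficit_{i,p}` (p481438 §4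
`sum_margin_mul_log_le_cellSlack_settingPrVolSharp`). [cite: DupuyHilado2025, §4.12] [claim: Mochizuki2012, status: disputed] -/
theorem sum_room_mul_log_le_neg_cellDeficit_settingPrVolSharp
    (r : ((thetaIndex X).Caps (Setting.labelSucc i) → (thetaIndex X).Fibre (.inr pp)) → ℤ)
    (hroom : ∀ e : (thetaIndex X).Caps (Setting.labelSucc i) → (thetaIndex X).Fibre (.inr pp),
      haveI : Fact (pp : ℕ).Prime := ⟨pp.2⟩;
      ((pp : ℕ) : ℝ) ^ m e * ‖tq pp (e (Fin.last _))‖ * ((pp : ℕ) : ℝ) ^ r e ≤ ∏ a, ‖cout (e a)‖) :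
    haveI : Fact (pp : ℕ).Prime := ⟨pp.2⟩;
    (∑ e : (presAt X hlog pp).toLocalPieces.E (Setting.labelSucc i), weightPr X pp.1 (Setting.labelSucc i) e * r e) *
        Real.log pp ≤
      -cellDeficit (settingPrVolSharp X hlog M archPk archSub Ψ act Mmod region n lat sig split qData tq t htq0 htq1) i (.inr pp) := by
  haveI : Fact (pp : ℕ).Prime := ⟨pp.2⟩
  have h := sum_margin_mul_log_le_cellSlack_settingPrVolSharp X hlog M archPk archSub Ψ act Mmod region n lat sig split qData t tq ht0 ht1 htq0 htq1
    i pp m hm0 hm1 houtΛ hdom r hroom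
  unfold cellDeficit
  rw [settingPrVolSharp_n]
  linarith

include ht0 ht1 hm0 hm1 houtΛ hdom in
/-- Hence room bounds the cell's CREDIT summand from below: `(Σ Pr·r)·log p ≤ (−cellDeficit_{i,p})⁺`. [claim: Mochizuki2012, status: disputed] -/
theorem sum_room_mul_log_le_cellCredit_settingPrVolSharp
    (r : ((thetaIndex X).Caps (Setting.labelSucc i) → (thetaIndex X).Fibre (.inr pp)) → ℤ)
    (hroom : ∀ e : (thetaIndex X).Caps (Setting.labelSucc i) → (thetaIndex X).Fibre (.inr pp),
      haveI : Fact (pp : ℕ).Prime := ⟨pp.2⟩;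
      ((pp : ℕ) : ℝ) ^ m e * ‖tq pp (e (Fin.last _))‖ * ((pp : ℕ) : ℝ) ^ r e ≤ ∏ a, ‖cout (e a)‖) :
    haveI : Fact (pp : ℕ).Prime := ⟨pp.2⟩;
    (∑ e : (presAt X hlog pp).toLocalPieces.E (Setting.labelSucc i), weightPr X pp.1 (Setting.labelSucc i) e * r e) *
        Real.log pp ≤
      max (-cellDeficit (settingPrVolSharp X hlog M archPk archSub Ψ act Mmod region n lat sig split qData tq t htq0 htq1) i (.inr pp)) 0 :=
  (sum_room_mul_log_le_neg_cellDeficit_settingPrVolSharp X hlog M archPk archSub Ψ act Mmod region n lat sig split qData t tq ht0 ht1 htq0 htq1 i pp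
    m hm0 hm1 houtΛ hdom r hroom).trans (le_max_left _ _)

include ht0 ht1 hm0 hm1 houtΛ hdom in
/-- **NO MORE CREDIT THAN ROOM**: if at every tuple `∏_a ‖c^out(v_a)‖ ≤ p^{m(v⃗)}·‖t_{q,v_j}‖·p^{r(v⃗)}`, then `−(Σ Pr·r)·log p ≤ cellDeficit_{i,p}`
(p481438 §4 `cellSlack_settingPrVolSharp_le_sum_margin_mul_log`). [cite: DupuyHilado2025, §4.12] [claim: Mochizuki2012, status: disputed] -/
theorem neg_sum_room_mul_log_le_cellDeficit_settingPrVolSharp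
    (r : ((thetaIndex X).Caps (Setting.labelSucc i) → (thetaIndex X).Fibre (.inr pp)) → ℤ)
    (hroom : ∀ e : (thetaIndex X).Caps (Setting.labelSucc i) → (thetaIndex X).Fibre (.inr pp),
      haveI : Fact (pp : ℕ).Prime := ⟨pp.2⟩;
      ∏ a, ‖cout (e a)‖ ≤ ((pp : ℕ) : ℝ) ^ m e * ‖tq pp (e (Fin.last _))‖ * ((pp : ℕ) : ℝ) ^ r e) :
    haveI : Fact (pp : ℕ).Prime := ⟨pp.2⟩;
    -((∑ e : (presAt X hlog pp).toLocalPieces.E (Setting.labelSucc i), weightPr X pp.1 (Setting.labelSucc i) e * r e) *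
        Real.log pp) ≤
      cellDeficit (settingPrVolSharp X hlog M archPk archSub Ψ act Mmod region n lat sig split qData tq t htq0 htq1) i (.inr pp) := by
  haveI : Fact (pp : ℕ).Prime := ⟨pp.2⟩
  have h := cellSlack_settingPrVolSharp_le_sum_margin_mul_log X hlog M archPk archSub Ψ act Mmod region n lat sig split qData t tq ht0 ht1 htq0 htq1
    i pp m hm0 hm1 houtΛ hdom r hroom
  unfold cellDeficit
  rw [settingPrVolSharp_n]
  linarith

end Cell

/-! ## §3. In total: `D`, `C`, `R_∅` of the netting currency in typ-4's binders -/

section Bill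

variable
  /- an exact content family at EVERY `(i, p)` (exists: `Cor312Vol.exists_content_slotUnion` cellwise) -/
  (m : ∀ (i : Fin (thetaIndex X).lstar) (pp : Nat.Primes),
    ((thetaIndex X).Caps (Setting.labelSucc i) → (thetaIndex X).Fibre (.inr pp)) → ℤ)
  (hm0 : ∀ (i : Fin (thetaIndex X).lstar) (pp : Nat.Primes)
      (e : (thetaIndex X).Caps (Setting.labelSucc i) → (thetaIndex X).Fibre (.inr pp)),
    haveI : Fact (pp : ℕ).Prime := ⟨pp.2⟩;
    (⋃ a, iota pp.1 ((presAt X hlog pp).kk e) a (t pp i (e a)) •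
        (normalizedPacket pp.1 ((presAt X hlog pp).kk e) : Set ((presAt X hlog pp).X e))) ⊆
      (((pp : ℕ) : ℚ_[pp]) ^ m i pp e) • (logPacket pp.1 ((presAt X hlog pp).kk e) : Set ((presAt X hlog pp).X e)))
  (hm1 : ∀ (i : Fin (thetaIndex X).lstar) (pp : Nat.Primes)
      (e : (thetaIndex X).Caps (Setting.labelSucc i) → (thetaIndex X).Fibre (.inr pp)),
    haveI : Fact (pp : ℕ).Prime := ⟨pp.2⟩;
    ¬ (⋃ a, iota pp.1 ((presAt X hlog pp).kk e) a (t pp i (e a)) •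
        (normalizedPacket pp.1 ((presAt X hlog pp).kk e) : Set ((presAt X hlog pp).X e))) ⊆
      (((pp : ℕ) : ℚ_[pp]) ^ (m i pp e + 1)) • (logPacket pp.1 ((presAt X hlog pp).kk e) : Set ((presAt X hlog pp).X e)))
  /- abc-iut-c312-5's outer radii at EVERY nonarchimedean place -/
  {cout : ∀ (pp : Nat.Primes) (x : (thetaIndex X).Fibre (.inr pp)), haveI : Fact (pp : ℕ).Prime := ⟨pp.2⟩; (presAt X hlog pp).k x}
  (houtΛ : ∀ (pp : Nat.Primes) (x : (thetaIndex X).Fibre (.inr pp)),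
    haveI : Fact (pp : ℕ).Prime := ⟨pp.2⟩; cout pp x ∈ logUnits ((presAt X hlog pp).k x))
  (hdom : ∀ (pp : Nat.Primes) (x : (thetaIndex X).Fibre (.inr pp)),
    haveI : Fact (pp : ℕ).Prime := ⟨pp.2⟩; ∀ z ∈ logUnits ((presAt X hlog pp).k x), ‖z‖ ≤ ‖cout pp x‖)

include ht0 ht1 hm0 hm1 houtΛ hdom in
/-- **Label by label**: `Σᶠ_{v_ℚ} cellDeficit_{i,v_ℚ} = −Σᶠ_p Σ_{v⃗} Pr(v⃗)·(−m_{i,p}·log p + Σ_a log‖c^out_p‖ − log‖t_q‖)` (p482070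
`finsum_cellSlack_settingPrVolSharp_eq`, sign flipped). [cite: DupuyHilado2025, §3.6, §3.9, §4.12] [claim: Mochizuki2012, status: disputed] -/
theorem finsum_cellDeficit_settingPrVolSharp_eq (i : Fin (thetaIndex X).lstar) :
    ∑ᶠ vQ : (thetaIndex X).VQ, cellDeficit (settingPrVolSharp X hlog M archPk archSub Ψ act Mmod region n lat sig split qData tq t htq0 htq1) i vQ =
      -∑ᶠ pp : Nat.Primes, haveI : Fact (pp : ℕ).Prime := ⟨pp.2⟩;
          ∑ e : (presAt X hlog pp).toLocalPieces.E (Setting.labelSucc i),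
            weightPr X pp.1 (Setting.labelSucc i) e *
              (-(m i pp e * Real.log pp) + ∑ a, Real.log ‖cout pp (e a)‖ - Real.log ‖tq pp (e (Fin.last _))‖) := by
  have h := finsum_cellSlack_settingPrVolSharp_eq X hlog M archPk archSub Ψ act Mmod region n lat sig split qData t tq ht0 ht1 htq0 htq1 m hm0
    hm1 houtΛ hdom i
  have key : (fun vQ : (thetaIndex X).VQ => cellDeficit (settingPrVolSharp X hlog M archPk archSub Ψ act Mmod region n lat sig split qData tq t htq0 htq1) i vQ) =
      fun vQ : (thetaIndex X).VQ =>
        -((((situationPrVol X hlog M archPk archSub Ψ act Mmod region).D n).logvol _ vQ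
            ((settingPrVolSharp X hlog M archPk archSub Ψ act Mmod region n lat sig split qData tq t htq0 htq1).thetaHull
              (Setting.labelSucc i) vQ) -
          (settingPrVolSharp X hlog M archPk archSub Ψ act Mmod region n lat sig split qData tq t htq0 htq1).qLocal
            (Setting.labelSucc i) vQ)) := by
    funext vQ
    unfold cellDeficit
    rw [settingPrVolSharp_n]
    ring
  rw [key, finsum_neg_distrib, h]

include ht0 ht1 hm0 hm1 houtΛ hdom in
/-- **THE LEAST SLACK IS MINUS THE FULL SIGNED BILL: `D = −PN(i ↦ Σᶠ_p Σ_{v⃗} Pr(v⃗)·(−m_{i,p}·log p + Σ_a log‖c^out_p‖ − log‖t_q‖))`** at the sharp real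
setting of record (q2-eq's `signedRemainder`, p480491, in abc-iut-rh-typ-4's kernel binders). With p479556 `statementUpTo_iff_signedRemainder_le` this is
p482070's `statement_settingPrVolSharp_iff_avg_signedBill` for every slack `ε`, not only `ε = 0`. [cite: Mochizuki2012, IUTchIII Cor. 3.12 p. 173–175, Prop. 3.9 (i)–(iii) p. 115–116]
[cite: DupuyHilado2025, §3.9, §4.12] [claim: Mochizuki2012, status: disputed] -/
theorem signedRemainder_settingPrVolSharp_eq :
    signedRemainder (settingPrVolSharp X hlog M archPk archSub Ψ act Mmod region n lat sig split qData tq t htq0 htq1) =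
      -processionNormalized (fun i : Fin (thetaIndex X).lstar =>
        ∑ᶠ pp : Nat.Primes, haveI : Fact (pp : ℕ).Prime := ⟨pp.2⟩;
          ∑ e : (presAt X hlog pp).toLocalPieces.E (Setting.labelSucc i),
            weightPr X pp.1 (Setting.labelSucc i) e *
              (-(m i pp e * Real.log pp) + ∑ a, Real.log ‖cout pp (e a)‖ - Real.log ‖tq pp (e (Fin.last _))‖)) := by
  have key := funext fun i : Fin (thetaIndex X).lstar =>
    finsum_cellDeficit_settingPrVolSharp_eq X hlog M archPk archSub Ψ act Mmod region n lat sig split qData t tq ht0 ht1 htq0 htq1 m hm0 hm1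
      houtΛ hdom i
  unfold signedRemainder
  rw [key]
  unfold processionNormalized
  rw [Finset.sum_neg_distrib, neg_div]

include ht0 ht1 hm0 hm1 houtΛ hdom in
/-- **THE CREDIT IS THE POSITIVE PART OF THE BILL, PACKET BY PACKET: `C = PN(i ↦ Σᶠ_p (Σ_{v⃗} Pr(v⃗)·(−m_{i,p}·log p + Σ_a log‖c^out_p‖ − log‖t_q‖))⁺)`**
(q2-eq's `credit`, p480491; archimedean cells contribute `0`). The D-0121 grid's «certified surplus» in kernel binders, by name.
[cite: DupuyHilado2025, §3.9, §4.12] [claim: Mochizuki2012, status: disputed] -/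
theorem credit_settingPrVolSharp_eq :
    credit (settingPrVolSharp X hlog M archPk archSub Ψ act Mmod region n lat sig split qData tq t htq0 htq1) =
      processionNormalized (fun i : Fin (thetaIndex X).lstar =>
        ∑ᶠ pp : Nat.Primes, haveI : Fact (pp : ℕ).Prime := ⟨pp.2⟩;
          max (∑ e : (presAt X hlog pp).toLocalPieces.E (Setting.labelSucc i),
            weightPr X pp.1 (Setting.labelSucc i) e *
              (-(m i pp e * Real.log pp) + ∑ a, Real.log ‖cout pp (e a)‖ - Real.log ‖tq pp (e (Fin.last _))‖)) 0) := by
  unfold credit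
  refine congrArg processionNormalized (funext fun i => ?_)
  refine (finsum_sum_eq_finsum_inr _ fun u => ?_).trans (finsum_congr fun pp => ?_)
  · show max (-cellDeficit (settingPrVolSharp X hlog M archPk archSub Ψ act Mmod region n lat sig split qData tq t htq0 htq1) i (.inl u)) 0 = 0
    rw [cellDeficit_settingPrVolSharp_inl X hlog M archPk archSub Ψ act Mmod region n lat sig split qData t tq htq0 htq1 i u,
      neg_zero, max_self]
  · exact cellCredit_settingPrVolSharp_inr_eq X hlog M archPk archSub Ψ act Mmod region n lat sig split qData t tq ht0 ht1 htq0 htq1 i pp (m i pp)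
      (hm0 i pp) (hm1 i pp) (houtΛ pp) (hdom pp)

include ht0 ht1 hm0 hm1 houtΛ hdom in
/-- **THE DEBT IS THE NEGATIVE PART OF THE BILL, PACKET BY PACKET: `R_∅ = PN(i ↦ Σᶠ_p (−Σ_{v⃗} Pr(v⃗)·(−m_{i,p}·log p + Σ_a log‖c^out_p‖ − log‖t_q‖))⁺)`**
(q2-eq's `offRemainder P ∅`, p476178 `offRemainder_empty_eq`; archimedean cells `0`). So the grid's netted `T′ = (R − C)⁺ = D⁺` and un-netted `R` are
both in kernel binders by name. [cite: DupuyHilado2025, §3.9, §4.12] [claim: Mochizuki2012, status: disputed] -/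
theorem offRemainder_empty_settingPrVolSharp_eq :
    offRemainder (settingPrVolSharp X hlog M archPk archSub Ψ act Mmod region n lat sig split qData tq t htq0 htq1) ∅ =
      processionNormalized (fun i : Fin (thetaIndex X).lstar =>
        ∑ᶠ pp : Nat.Primes, haveI : Fact (pp : ℕ).Prime := ⟨pp.2⟩;
          max (-∑ e : (presAt X hlog pp).toLocalPieces.E (Setting.labelSucc i),
            weightPr X pp.1 (Setting.labelSucc i) e *
              (-(m i pp e * Real.log pp) + ∑ a, Real.log ‖cout pp (e a)‖ - Real.log ‖tq pp (e (Fin.last _))‖)) 0) := by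
  rw [offRemainder_empty_eq]
  refine congrArg processionNormalized (funext fun i => ?_)
  refine (finsum_sum_eq_finsum_inr _ fun u => ?_).trans (finsum_congr fun pp => ?_)
  · show max (cellDeficit (settingPrVolSharp X hlog M archPk archSub Ψ act Mmod region n lat sig split qData tq t htq0 htq1) i (.inl u)) 0 = 0
    rw [cellDeficit_settingPrVolSharp_inl X hlog M archPk archSub Ψ act Mmod region n lat sig split qData t tq htq0 htq1 i u,
      max_self]
  · exact cellDebt_settingPrVolSharp_inr_eq X hlog M archPk archSub Ψ act Mmod region n lat sig split qData t tq ht0 ht1 htq0 htq1 i pp (m i pp)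
      (hm0 i pp) (hm1 i pp) (houtΛ pp) (hdom pp)

end Bill

end Summit.ABC.IUTFork.Repair.RH.SigmaStrataEq

end
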